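import Summits.BirchSwinnertonDyer.Rank1Residual.Additive.ShaDivisibilityOfTrivialPartner
import Summits.BirchSwinnertonDyer.Rank1Residual.AdditivePotMult.PotMultCongruentPairGV
import HarnessLib

/-!
# The (M) twin of FILE 5: the LOWER half and `BSD(E,p)` on a rank-`0` X4(M) row with
# `#Ш_an = p²·unit` from a TRIVIAL X4(M) CONGRUENT PARTNER with positive δ-shift, mod A40/A41
# (team n1011, row T-CTL-EC, seat p06 GEN 9, FILE 6)

HONEST FRAMING (cell `b2b-bsdres-*`, team n1011, verbatim): prove what is provable now; shrink each
hard class to its core with data; no claim beyond stated classes. Research route on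
CONSTRUCTION-SHAPED X4 / §I N10 (M) / N11 (M) @ 3; CONSUMER theorems only — no definition, no named
fact, nothing booked, no residual-map mark moved, no class closed: PER-PAIR shapes; which (M)|(M)
links of the registers satisfy them is census business, not claimed here.

## What

FILE 5 (`Additive/ShaDivisibilityOfTrivialPartner`) did this for X4♯(G-ord) ∩ `I₀*` pairs over
Coates–Greenberg. On X4(M)|X4(M) congruent pairs (both additive potentially MULTIPLICATIVE at `p`,
`E[p]` irreducible) the cell's GV transfer of record is `AdditivePotMult.ClassX4M.congruentLambdaShift_of_gv_of_torsionIso`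
/ `…mu_eq_zero_of_gv_of_torsionIso` (additive-p1 / p07 lineages; A240 `hGV` + the PUBLISHED Tate
uniformisation A40 `hT40` / A41 `hT41`; NO defect / line / R-D binder), and the `v ∋ p` socket is
p12's T-T3M `AdditivePotMult.ClassX4M.localTowerKerPrimary_zero_eq_bot (hT41)`. Composition:

* `ClassX4M.localTowerKerPrimary_zero_eq_bot_of_allNumeric` — socket dispatcher (F4-M at `v = p`,
  F2c elsewhere);
* `ClassX4M.lambda_ne_zero_of_gv_of_trivialPartner` — PRINTED {`hGV`, `hT40`, `hT41`, GZK} + partner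
  census {`hX₁`, `#Sel_{p^∞}(E₁/ℚ) = 1`, numeric sockets} + receiver census {`hX₂`, `r_an = 0`, numeric
  sockets} + link {`TorsionIso W₁ W₂ p`, `S₀`, `Σ δ(E₂) < Σ δ(E₁)`} ⟹ `λ(X(E₂/ℚ_∞)) ≠ 0` (every odd `p`);
* `ClassX4M.missingLowerBoundAt_rankZero_of_gv_of_trivialPartner_of_casselsTate` — **the LOWER half on
  the receiver when `ord_p #Ш_an(E₂) ≤ 2`, NO typed input**, every odd `p` incl. `3`;
* `ClassX4M.bsdp_rankZero_of_gv_of_trivialPartner_of_casselsTate` — **`BSD(E₂,p)`**, every odd `p`,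
  `ρ̄_{E₂,p}` onto; upper half = `AdditivePotMult.ClassX4M.missingUpperBoundAt_rankZero_of_surj`
  (Delbourgo 1998 Prop. 4, Wuthrich Lemma 20, Kato component — the kernel upper half of record).

Axioms standard. References: [GreenbergVatsal2000] §2; [SilvermanATAEC1994] V.5.3/5.4;
[SilvermanAEC2009] X.4.14; [Delbourgo1998] Prop. 4, §2.2 Lemma (ii); [GreenbergLNM1716] §3–§4;
[Miller2011LMS] Def. 1.1; cells/n1011/skel/T-CTL-EC.md.
-/

noncomputable section

open scoped Classical NumberField

open WeierstrassCurve NumberField IsDedekindDomain Field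
  Literature.NumberTheory.GaloisRepresentations
  Literature.NumberTheory.EllipticCurves
  Literature.NumberTheory.EllipticCurves.ModularForms
  Literature.NumberTheory.EllipticCurves.Rank1Residual
  Literature.NumberTheory.EllipticCurves.Rank1Residual.Typed
  Literature.NumberTheory.EllipticCurves.GreenbergVatsal2000
  Rat.HeightOneSpectrum Summit.BirchSwinnertonDyer.Rank1Residual.Iwasawa
  Summit.BirchSwinnertonDyer.Rank1Residual.X1.CongruenceTransfer

namespace Summit.BirchSwinnertonDyer.Rank1Residual.Additive

variable {W₁ W₂ : WeierstrassCurve ℚ} [W₁.IsElliptic] [W₁.IsGloballyMinimal] [W₂.IsElliptic]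
  [W₂.IsGloballyMinimal] {p : ℕ} [hp : Fact p.Prime]

/-- All level-`0` local tower kernels of an X4(M) curve vanish when every bad place away from `p`
passes the numeric test (`v = p`: T-T3M F4-M mod A41; `v ∤ p` bad: F2c; good: Lemma 3.3).
[cite: Delbourgo1998, §2.2 Lemma (ii) (p. 139)] [cite: GreenbergLNM1716, §3 Prop. 3.8 (pp. 95–96), Lemma 3.3 (p. 87)]
[cite: SilvermanATAEC1994, Ch. V Thm. 5.3, Cor. 5.4] -/
theorem ClassX4M.localTowerKerPrimary_zero_eq_bot_of_allNumeric {W : WeierstrassCurve ℚ}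
    [W.IsElliptic] [W.IsGloballyMinimal] (hT41 : Silverman1994_thmV53_corV54_tateUniformisation.{0})
    (hX : AdditivePotMult.ClassX4M W p) (κ : ZpExtension ℚ p) (S : Finset (HeightOneSpectrum (𝓞 ℚ)))
    (hS : ∀ v ∈ S, (p : 𝓞 ℚ) ∉ v.asIdeal →
      (primesEquiv v : ℕ) ≠ p ∧ ¬ p ∣ (W.baseChange (v.adicCompletion ℚ)).localTamagawaNumber
        (v.adicCompletionIntegers ℚ) * reductionPointCount W (primesEquiv v : ℕ))
    (hgood : ∀ v ∉ S, (p : 𝓞 ℚ) ∉ v.asIdeal ∧ W.HasGoodReductionAt v)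
    (v : HeightOneSpectrum (𝓞 ℚ)) : W.localTowerKerPrimary κ (v.adicCompletion ℚ) 0 = ⊥ := by
  refine localTowerKerPrimary_zero_eq_bot_of_finset W κ S (fun v hv ↦ ?_) hgood v
  by_cases hpv : (p : 𝓞 ℚ) ∈ v.asIdeal
  · exact AdditivePotMult.ClassX4M.localTowerKerPrimary_zero_eq_bot hT41 hX hpv κ
  · obtain ⟨hne, hnum⟩ := hS v hv hpv
    haveI : Fact (Nat.Prime (primesEquiv v : ℕ)) := ⟨(primesEquiv v).2⟩
    exact localTowerKerPrimary_zero_eq_bot_of_not_dvd W κ v (primesEquiv v : ℕ) rfl hne hpv hnum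

/-- **X4(M)|X4(M) pair, TRIVIAL partner, positive δ-shift ⟹ `λ(X(E₂/ℚ_∞)) ≠ 0`** for every
cyclotomic dual datum (every odd `p`), mod A40/A41. `X(E₁) = 0` by T-T3CTL F1 + the numeric sockets;
`X(E₂)` torsion by FILE 1's control identity (GZK: `Sel_{p^∞}(E₂/ℚ)` finite in analytic rank `0`).
Nothing booked. [cite: GreenbergVatsal2000, §2 Prop. (2.8) with Remark (2.9), Cor. (2.3), pp. 26–27 (arXiv:math/9906215)]
[cite: SilvermanATAEC1994, Ch. V Thm. 5.3, Cor. 5.4] [cite: GreenbergLNM1716, §3 Prop. 3.8 and §4 Thm. 4.1] -/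
theorem ClassX4M.lambda_ne_zero_of_gv_of_trivialPartner
    (hGV : muLambdaAlg_transfer_of_torsionIso_potOrd_of_not_dvd_torsionOrder)
    (hT40 : Silverman1994_thmV53_tateUniformisation.{0})
    (hT41 : Silverman1994_thmV53_corV54_tateUniformisation.{0})
    (hGZK : rank_eq_analyticRank_of_analyticRank_le_one)
    -- partner (trivial at p)
    (hX₁ : AdditivePotMult.ClassX4M W₁ p) (hSel₁ : Nat.card (W₁.selmerGroupPInfty p) = 1)
    (S₁ : Finset (HeightOneSpectrum (𝓞 ℚ)))
    (hS₁ : ∀ v ∈ S₁, (p : 𝓞 ℚ) ∉ v.asIdeal →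
      (primesEquiv v : ℕ) ≠ p ∧ ¬ p ∣ (W₁.baseChange (v.adicCompletion ℚ)).localTamagawaNumber
        (v.adicCompletionIntegers ℚ) * reductionPointCount W₁ (primesEquiv v : ℕ))
    (hgood₁ : ∀ v ∉ S₁, (p : 𝓞 ℚ) ∉ v.asIdeal ∧ W₁.HasGoodReductionAt v)
    -- receiver (rank 0)
    (hX₂ : AdditivePotMult.ClassX4M W₂ p) (hr₂ : W₂.analyticRank = 0)
    (S₂ : Finset (HeightOneSpectrum (𝓞 ℚ)))
    (hS₂ : ∀ v ∈ S₂, (p : 𝓞 ℚ) ∉ v.asIdeal →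
      (primesEquiv v : ℕ) ≠ p ∧ ¬ p ∣ (W₂.baseChange (v.adicCompletion ℚ)).localTamagawaNumber
        (v.adicCompletionIntegers ℚ) * reductionPointCount W₂ (primesEquiv v : ℕ))
    (hgood₂ : ∀ v ∉ S₂, (p : 𝓞 ℚ) ∉ v.asIdeal ∧ W₂.HasGoodReductionAt v)
    -- link
    (hT : TorsionIso W₁ W₂ p) (S₀ : Finset (HeightOneSpectrum (𝓞 ℚ)))
    (hS₀ : ∀ w ∈ S₀, ((p : ℕ) : 𝓞 ℚ) ∉ w.asIdeal)
    (hS₀₁ : ∀ w : HeightOneSpectrum (𝓞 ℚ), w ∉ S₀ → ((p : ℕ) : 𝓞 ℚ) ∉ w.asIdeal →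
      W₁.HasGoodReductionAt w)
    (hS₀₂ : ∀ w : HeightOneSpectrum (𝓞 ℚ), w ∉ S₀ → ((p : ℕ) : 𝓞 ℚ) ∉ w.asIdeal →
      W₂.HasGoodReductionAt w)
    (hδ : ∑ w ∈ S₀, delta W₂ p w < ∑ w ∈ S₀, delta W₁ p w)
    {κ : ZpExtension ℚ p} {γ : Field.absoluteGaloisGroup ℚ} (hκ : κ.IsCyclotomic)
    (hγ : κ.IsTopGenerator γ) (hγ' : IsCyclotomicVariable p γ) (D₂ : W₂.SelmerDualData κ γ) :
    D₂.lambda ≠ 0 := by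
  obtain ⟨D₁⟩ := W₁.nonempty_selmerDualData_holds κ γ hγ
  haveI : Subsingleton D₁.X :=
    subsingleton_X_of_card_selmer_eq_one_of_localTowerKerPrimary_eq_bot D₁ hγ hSel₁
      (ClassX4M.localTowerKerPrimary_zero_eq_bot_of_allNumeric hT41 hX₁ κ S₁ hS₁ hgood₁)
  haveI : Module.Finite (IwasawaAlgebra p) D₁.X :=
    SelmerDualData.module_finite_of_isCyclotomic (W := W₁) (κ := κ) hκ D₁ hγ
  obtain ⟨hrk, hfin⟩ := hGZK W₂ (by omega)
  have hrank : W₂.mordellWeilRank = 0 := by rw [hrk, hr₂]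
  haveI : Finite W₂.toAffine.Point := W₂.mordellWeilRank_eq_zero_iff_finite.mp hrank
  haveI : Finite W₂.sha := hfin
  haveI : Finite (AddCommGroup.primaryComponent W₂.sha p) := inferInstance
  have hSel₂ : Finite (W₂.selmerGroupPInfty p) :=
    W₂.finite_selmerGroupPInfty_of_finite_primaryComponent p
  have hK₂ := forall_smul_eq_zero_imp_of_not_dvd_torsionOrder W₂ (p := p)
    (Supersingular.not_dvd_torsionOrder_of_irr W₂ p hX₂.irr)
  haveI : (Module.charIdeal (IwasawaAlgebra p) D₂.X).IsPrincipal := charIdeal_isPrincipal_holds p D₂.X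
  obtain ⟨f₂, hf₂⟩ := Submodule.IsPrincipal.principal (Module.charIdeal (IwasawaAlgebra p) D₂.X)
  have hf₂' : D₂.charIdeal = Ideal.span {f₂} := hf₂
  obtain ⟨hFG₂, hX₂t, -⟩ := constantCoeff_mul_natCard_eq_of_no_pTorsion W₂ D₂ hγ hSel₂ hK₂ f₂ hf₂'
    (ClassX4M.localTowerKerPrimary_zero_eq_bot_of_allNumeric hT41 hX₂ κ S₂ hS₂ hgood₂)
  haveI := hFG₂
  have hμ₂ : D₂.mu = 0 :=
    AdditivePotMult.ClassX4M.mu_eq_zero_of_gv_of_torsionIso hGV hT40 hT41 hX₁ hX₂ hT S₀ hS₀ hS₀₁ hS₀₂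
      hκ hγ hγ' D₁ D₂ (isTorsion_of_subsingleton D₁) hX₂t (mu_eq_zero_of_subsingleton D₁)
  have hshift := AdditivePotMult.ClassX4M.congruentLambdaShift_of_gv_of_torsionIso hGV hT40 hT41 hX₁
    hX₂ hT S₀ hS₀ hS₀₁ hS₀₂
  have he : ∑ w ∈ S₀, ((delta W₂ p w : ℤ) - (delta W₁ p w : ℤ)) < 0 := by
    rw [Finset.sum_sub_distrib]
    have h1 : ((∑ w ∈ S₀, delta W₂ p w : ℕ) : ℤ) < ((∑ w ∈ S₀, delta W₁ p w : ℕ) : ℤ) := by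
      exact_mod_cast hδ
    push_cast at h1
    linarith
  exact lambda_ne_zero_of_congruentLambdaShift_of_subsingleton hT hshift he hκ hγ hγ' D₁ D₂ hX₂t hμ₂

/-- **THE LOWER HALF ON THE X4(M) RECEIVER, NO TYPED INPUT** (every odd `p` incl. `3`): X4(M)|X4(M)
pair, trivial partner, positive δ-shift, `ord_p #Ш_an(E₂) ≤ 2` ⟹ `Typed.MissingLowerBoundAt W₂ p`,
granted Cassels–Tate, A240, A40/A41, GZK. Nothing booked. [cite: SilvermanAEC2009, Thm. X.4.14]
[cite: GreenbergVatsal2000, §2 Prop. (2.8), Cor. (2.3), pp. 26–27] [cite: SilvermanATAEC1994, Ch. V Thm. 5.3, Cor. 5.4]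
[cite: Miller2011LMS, Def. 1.1] -/
theorem ClassX4M.missingLowerBoundAt_rankZero_of_gv_of_trivialPartner_of_casselsTate
    (hCT : exists_casselsTate_pairing (K := ℚ))
    (hGV : muLambdaAlg_transfer_of_torsionIso_potOrd_of_not_dvd_torsionOrder)
    (hT40 : Silverman1994_thmV53_tateUniformisation.{0})
    (hT41 : Silverman1994_thmV53_corV54_tateUniformisation.{0})
    (hGZK : rank_eq_analyticRank_of_analyticRank_le_one)
    (hX₁ : AdditivePotMult.ClassX4M W₁ p) (hSel₁ : Nat.card (W₁.selmerGroupPInfty p) = 1)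
    (S₁ : Finset (HeightOneSpectrum (𝓞 ℚ)))
    (hS₁ : ∀ v ∈ S₁, (p : 𝓞 ℚ) ∉ v.asIdeal →
      (primesEquiv v : ℕ) ≠ p ∧ ¬ p ∣ (W₁.baseChange (v.adicCompletion ℚ)).localTamagawaNumber
        (v.adicCompletionIntegers ℚ) * reductionPointCount W₁ (primesEquiv v : ℕ))
    (hgood₁ : ∀ v ∉ S₁, (p : 𝓞 ℚ) ∉ v.asIdeal ∧ W₁.HasGoodReductionAt v)
    (hX₂ : AdditivePotMult.ClassX4M W₂ p) (hr₂ : W₂.analyticRank = 0)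
    (S₂ : Finset (HeightOneSpectrum (𝓞 ℚ)))
    (hS₂ : ∀ v ∈ S₂, (p : 𝓞 ℚ) ∉ v.asIdeal →
      (primesEquiv v : ℕ) ≠ p ∧ ¬ p ∣ (W₂.baseChange (v.adicCompletion ℚ)).localTamagawaNumber
        (v.adicCompletionIntegers ℚ) * reductionPointCount W₂ (primesEquiv v : ℕ))
    (hgood₂ : ∀ v ∉ S₂, (p : 𝓞 ℚ) ∉ v.asIdeal ∧ W₂.HasGoodReductionAt v)
    (hT : TorsionIso W₁ W₂ p) (S₀ : Finset (HeightOneSpectrum (𝓞 ℚ)))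
    (hS₀ : ∀ w ∈ S₀, ((p : ℕ) : 𝓞 ℚ) ∉ w.asIdeal)
    (hS₀₁ : ∀ w : HeightOneSpectrum (𝓞 ℚ), w ∉ S₀ → ((p : ℕ) : 𝓞 ℚ) ∉ w.asIdeal →
      W₁.HasGoodReductionAt w)
    (hS₀₂ : ∀ w : HeightOneSpectrum (𝓞 ℚ), w ∉ S₀ → ((p : ℕ) : 𝓞 ℚ) ∉ w.asIdeal →
      W₂.HasGoodReductionAt w)
    (hδ : ∑ w ∈ S₀, delta W₂ p w < ∑ w ∈ S₀, delta W₁ p w)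
    (hsha : ∃ s : ℚ, shaAn W₂ = (s : ℂ) ∧ padicValRat p s ≤ 2) : MissingLowerBoundAt W₂ p := by
  obtain ⟨κ, hκ, γ, hγ, hγ'⟩ := exists_isCyclotomic_isTopGenerator_isCyclotomicVariable_holds p
  obtain ⟨D₂⟩ := W₂.nonempty_selmerDualData_holds κ γ hγ
  exact ClassX4M.missingLowerBoundAt_rankZero_of_lambda_ne_zero_of_casselsTate hCT hT41 hX₂ hGZK hr₂ D₂
    hγ (ClassX4M.lambda_ne_zero_of_gv_of_trivialPartner hGV hT40 hT41 hGZK hX₁ hSel₁ S₁ hS₁ hgood₁ hX₂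
      hr₂ S₂ hS₂ hgood₂ hT S₀ hS₀ hS₀₁ hS₀₂ hδ hκ hγ hγ' D₂) S₂ hS₂ hgood₂ hsha

/-- **CAPSTONE — `BSD(E₂,p)` on the X4(M) receiver, every odd `p` incl. `3`, every input PRINTED or
census**: PRINTED {Cassels–Tate, A240, A40/A41, Delbourgo 1998 Prop. 4, GZK, modularity, Wuthrich
Lemma 20, Kato component} + partner census {`hX₁`, `#Sel₁ = 1`, numeric sockets} + receiver census
{`hX₂`, `r_an = 0`, `ρ̄` onto, numeric sockets, `#Ш_an = s` with `ord_p s ≤ 2`} + link {`TorsionIso`,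
`S₀`, δ-inequality}. X4(M) is NOT closed as a class; nothing booked.
[cite: Delbourgo1998, Prop. 4 (p. 144)] [cite: SilvermanATAEC1994, Ch. V Thm. 5.3, Cor. 5.4]
[cite: SilvermanAEC2009, Thm. X.4.14] [cite: GreenbergVatsal2000, §2 Prop. (2.8), Cor. (2.3), pp. 26–27]
[cite: Miller2011LMS, Def. 1.1] -/
theorem ClassX4M.bsdp_rankZero_of_gv_of_trivialPartner_of_casselsTate
    (hCT : exists_casselsTate_pairing (K := ℚ))
    (hGV : muLambdaAlg_transfer_of_torsionIso_potOrd_of_not_dvd_torsionOrder)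
    (hT40 : Silverman1994_thmV53_tateUniformisation.{0})
    (hT41 : Silverman1994_thmV53_corV54_tateUniformisation.{0})
    (hDel98 : Delbourgo1998.prop4_rankZero_pow_dvd_constantCoeff)
    (hGZK : rank_eq_analyticRank_of_analyticRank_le_one) (hmod : hasEntireLFunction_rat)
    (hmodD : nonempty_modularParametrizationData)
    (hL20 : Wuthrich2014.lemma20_surjective_threeAdic_of_semistable)
    (hKato : Wuthrich2014.kato_halfEigenCharIdeal_dvd_cyclotomicPrime_of_surjective)
    -- partner
    (hX₁ : AdditivePotMult.ClassX4M W₁ p) (hSel₁ : Nat.card (W₁.selmerGroupPInfty p) = 1)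
    (S₁ : Finset (HeightOneSpectrum (𝓞 ℚ)))
    (hS₁ : ∀ v ∈ S₁, (p : 𝓞 ℚ) ∉ v.asIdeal →
      (primesEquiv v : ℕ) ≠ p ∧ ¬ p ∣ (W₁.baseChange (v.adicCompletion ℚ)).localTamagawaNumber
        (v.adicCompletionIntegers ℚ) * reductionPointCount W₁ (primesEquiv v : ℕ))
    (hgood₁ : ∀ v ∉ S₁, (p : 𝓞 ℚ) ∉ v.asIdeal ∧ W₁.HasGoodReductionAt v)
    -- receiver
    (hX₂ : AdditivePotMult.ClassX4M W₂ p) (hr₂ : W₂.analyticRank = 0) (hsurj₂ : Surj W₂ p)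
    (S₂ : Finset (HeightOneSpectrum (𝓞 ℚ)))
    (hS₂ : ∀ v ∈ S₂, (p : 𝓞 ℚ) ∉ v.asIdeal →
      (primesEquiv v : ℕ) ≠ p ∧ ¬ p ∣ (W₂.baseChange (v.adicCompletion ℚ)).localTamagawaNumber
        (v.adicCompletionIntegers ℚ) * reductionPointCount W₂ (primesEquiv v : ℕ))
    (hgood₂ : ∀ v ∉ S₂, (p : 𝓞 ℚ) ∉ v.asIdeal ∧ W₂.HasGoodReductionAt v)
    (hsha : ∃ s : ℚ, shaAn W₂ = (s : ℂ) ∧ padicValRat p s ≤ 2)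
    -- link
    (hT : TorsionIso W₁ W₂ p) (S₀ : Finset (HeightOneSpectrum (𝓞 ℚ)))
    (hS₀ : ∀ w ∈ S₀, ((p : ℕ) : 𝓞 ℚ) ∉ w.asIdeal)
    (hS₀₁ : ∀ w : HeightOneSpectrum (𝓞 ℚ), w ∉ S₀ → ((p : ℕ) : 𝓞 ℚ) ∉ w.asIdeal →
      W₁.HasGoodReductionAt w)
    (hS₀₂ : ∀ w : HeightOneSpectrum (𝓞 ℚ), w ∉ S₀ → ((p : ℕ) : 𝓞 ℚ) ∉ w.asIdeal →
      W₂.HasGoodReductionAt w)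
    (hδ : ∑ w ∈ S₀, delta W₂ p w < ∑ w ∈ S₀, delta W₁ p w) : BSDp W₂ p :=
  bsdp_of_missingPPartAt W₂ p hGZK (by rw [hr₂]; exact zero_le_one)
    (missingPPartAt_of_lower_of_upper W₂ p
      (ClassX4M.missingLowerBoundAt_rankZero_of_gv_of_trivialPartner_of_casselsTate hCT hGV hT40 hT41
        hGZK hX₁ hSel₁ S₁ hS₁ hgood₁ hX₂ hr₂ S₂ hS₂ hgood₂ hT S₀ hS₀ hS₀₁ hS₀₂ hδ hsha)
      (AdditivePotMult.ClassX4M.missingUpperBoundAt_rankZero_of_surj hDel98 hGZK hmod hmodD hL20 hKato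
        hX₂ hr₂ hsurj₂))

end Summit.BirchSwinnertonDyer.Rank1Residual.Additive

end
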